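import Summits.AtomisticToContinuum.FouriersLaw.Theses.KineticCorner
import Summits.AtomisticToContinuum.FouriersLaw.Theorems.EmbeddedDrudeMourreDrudeDissolutionPoissonSandwich
import Summits.AtomisticToContinuum.FouriersLaw.Theorems.EmbeddedDrudeMourreDrudeDissolutionOfBmKineticCruxes
import Summits.AtomisticToContinuum.FouriersLaw.Theorems.EmbeddedDrudeMourreDrudeDissolutionStubAbelFloorOfWindowLimits
import Summits.AtomisticToContinuum.FouriersLaw.Theorems.KineticCornerStationaryCorrelationBound

/-!
# The kinetic Abel floor from kinetic window limits — line `natural-scale-poisson-sandwich`, time side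
(crux `EmbeddedDrudeMourre.DrudeDissolution`, stmt-AtomisticToContinuum-12593; `--supports` file, closes nothing)

Second half of the durable part of the line's skeleton (planner v3; lead a1). The time-side stub T
(`stub_kineticAbelFloor`: a `T`-uniform floor `a₀ ≤ ∫₀^∞ e^{−νT²t} C_T(t) dt` of the canonical summed current
autocorrelation for `ν ∈ (0, ν₀]`, `T < T₀(ν)`) follows from kinetic WINDOW limits of the shape of route KineticCorner's
`KineticLimit` (stmt-AtomisticToContinuum-3431), in their existential Buttà–Marchioro form KL∃, through

* the LANDED Abel-summation lemma B `NaturalScalePoissonSandwich.stub_abelFloor_of_windowLimits` (p132245),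
* rigidity of the BM class `LineSketch.stub_bmRigidity` (p127446) — every BM-class pair at `T` has the canonical `C_T` of
  `MourreDissolution.canonicalDatum` (p121356) — and the a-priori bound `|C_T| ≤ B T²`
  (`KineticCorner.stationaryCorrelationBound_proof`, stmt-3435),
* `LineSketch.bmKineticLimit_of_kineticLimit` (p127311): stmt-3431 ⇒ KL∃.

Hence `kineticAbelFloor_of_kineticLimit : KineticLimit → T` and, with the sandwich composition
(`drudeDissolution_of_windowModulus_of_kineticAbelFloor`, file `…DrudeDissolutionPoissonSandwich`),
`drudeDissolution_of_windowModulus_of_kineticLimit : F → KineticLimit → DrudeDissolution`.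
-/

noncomputable section

open MeasureTheory Filter Set Function
open scoped Topology ENNReal

namespace Summit.AtomisticToContinuum.FouriersLaw.Theorems.DrudeDissolution.NaturalScalePoissonSandwich

open Literature.MathematicalPhysics.KineticTheory.HeatConduction


/-- **B ∧ KL∃ ⇒ T.** The existential Buttà–Marchioro form KL∃ of `KineticCorner.KineticLimit` (verbatim the registered stub
`stub_bmKineticLimit` of line `Sketch`; implied by stmt-3431 via the landed `LineSketch.bmKineticLimit_of_kineticLimit`,
p127311) and the Abel-summation lemma B give the kinetic Abel floor T: the canonical datum `D` of `canonicalDatum` with its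
DLR states `Z_T.μ` defines ONE family `C T := D.currentCorrelation Z_T.μ` (continuous, `|C T t| ≤ B T²` for `T < T₁` by
`KineticCorner.stationaryCorrelationBound_proof`, stmt-3435); every KL∃-pair at `T` has this `C T` by rigidity
(`LineSketch.stub_bmRigidity`), so B applies, and the T-witness at `T` is the canonical datum itself. [folklore] -/
theorem kineticAbelFloor_of_bmKineticLimit
    (hB : ∀ (C : ℝ → ℝ → ℝ) (K : ℝ → ℝ) (B T₁ : ℝ), 0 < T₁ →
      IntegrableOn K (Ioi 0) → 0 < ∫ τ in Ioi 0, K τ →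
      (∀ T : ℝ, 0 < T → T < T₁ → Continuous (C T)) →
      (∀ T : ℝ, 0 < T → T < T₁ → ∀ t : ℝ, 0 ≤ t → |C T t| ≤ B * T ^ 2) →
      (∀ δ M e : ℝ, 0 < δ → δ ≤ M → 0 < e → ∃ T₀ : ℝ, 0 < T₀ ∧ ∀ T : ℝ, 0 < T → T < T₀ →
          |(∫ t in (δ / T ^ 2)..(M / T ^ 2), C T t) - ∫ τ in δ..M, K τ| ≤ e) →
      ∃ a₀ ν₀ : ℝ, 0 < a₀ ∧ 0 < ν₀ ∧ ∀ ν : ℝ, 0 < ν → ν ≤ ν₀ →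
        ∃ T₀ : ℝ, 0 < T₀ ∧ ∀ T : ℝ, 0 < T → T < T₀ →
          a₀ ≤ ∫ t in Ioi (0 : ℝ), Real.exp (-(ν * T ^ 2 * t)) * C T t)
    (hKL : ∀ ω₂ lam β γ : ℝ, 0 < ω₂ → 0 < lam → 0 < β → 0 < γ →
      ∃ K : ℝ → ℝ, IntegrableOn K (Ioi 0) ∧ 0 < ∫ τ in Ioi 0, K τ ∧
        ∀ δ M e : ℝ, 0 < δ → δ ≤ M → 0 < e → ∃ T₀ : ℝ, 0 < T₀ ∧ ∀ T : ℝ, 0 < T → T < T₀ →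
          ∃ (μ : Measure ChainConfig) (D : InfiniteChainDynamics (pinnedChain ω₂ lam β γ)),
            (pinnedChain ω₂ lam β γ).IsChainGibbsMeasure T μ ∧
            MeasurePreserving (fun σ : ChainConfig => fun i : ℤ => σ (i + 1)) μ μ ∧
            D.carrier = (pinnedChain ω₂ lam β γ).bmGood ∧
            D.PreservesMeasure μ ∧
            |(∫ t in (δ / T ^ 2)..(M / T ^ 2), D.currentCorrelation μ t) - ∫ τ in δ..M, K τ| ≤ e) :
    ∀ ω₂ lam β γ : ℝ, 0 < ω₂ → 0 < lam → 0 < β → 0 < γ →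
      ∃ a₀ ν₀ : ℝ, 0 < a₀ ∧ 0 < ν₀ ∧ ∀ ν : ℝ, 0 < ν → ν ≤ ν₀ →
        ∃ T₀ : ℝ, 0 < T₀ ∧ ∀ T : ℝ, 0 < T → T < T₀ →
          ∃ (μ : Measure ChainConfig) (D : InfiniteChainDynamics (pinnedChain ω₂ lam β γ)),
            (pinnedChain ω₂ lam β γ).IsChainGibbsMeasure T μ ∧
            MeasurePreserving (fun σ : ChainConfig => fun i : ℤ => σ (i + 1)) μ μ ∧
            D.carrier = (pinnedChain ω₂ lam β γ).bmGood ∧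
            D.PreservesMeasure μ ∧
            a₀ ≤ ∫ t in Ioi (0 : ℝ), Real.exp (-(ν * T ^ 2 * t)) * D.currentCorrelation μ t := by
  intro ω₂ lam β γ hω hl hβ hγ
  obtain ⟨K, hKint, hKpos, hwin⟩ := hKL ω₂ lam β γ hω hl hβ hγ
  obtain ⟨B, T₁, hT₁, hSCB⟩ := Theorems.KineticCorner.stationaryCorrelationBound_proof ω₂ lam β γ hω hl hβ hγ
  obtain ⟨D, hD, hshD, hZ⟩ := Theorems.MourreDissolution.canonicalDatum ω₂ lam β γ hω hl hβ
  classical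
  -- the canonical correlation family (junk value `0` at `T ≤ 0`)
  let C : ℝ → ℝ → ℝ := fun T t =>
    if hT : 0 < T then D.currentCorrelation (Classical.choose (hZ T hT)).μ t else 0
  have hC : ∀ (T : ℝ) (hT : 0 < T), C T = D.currentCorrelation (Classical.choose (hZ T hT)).μ := by
    intro T hT
    funext t
    simp only [C, dif_pos hT]
  -- its properties: continuity, a-priori bound, window limits (by rigidity)
  have hgoodT : ∀ (T : ℝ) (hT : 0 < T),
      (pinnedChain ω₂ lam β γ).IsChainGibbsMeasure T (Classical.choose (hZ T hT)).μ ∧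
      D.PreservesMeasure (Classical.choose (hZ T hT)).μ ∧
      (∀ t : ℝ, D.HasAbsConvergentCorrelation (Classical.choose (hZ T hT)).μ t) ∧
      (∀ S : ℝ, IntegrableOn (D.currentCorrelation (Classical.choose (hZ T hT)).μ) (Set.Icc 0 S)) ∧
      MeasurePreserving (fun σ : ChainConfig => fun i : ℤ => σ (i + 1))
        (Classical.choose (hZ T hT)).μ (Classical.choose (hZ T hT)).μ ∧
      (∀ (t : ℝ) (σ : ChainConfig), D.flow t (fun i : ℤ => σ (i + 1)) = fun i : ℤ => D.flow t σ (i + 1)) :=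
    fun T hT => Theorems.MourreDissolution.goodTriple_of_canonicalDatum hshD _
      (Classical.choose_spec (hZ T hT)).1 (Classical.choose_spec (hZ T hT)).2.2.2
  have hcont : ∀ T : ℝ, 0 < T → T < T₁ → Continuous (C T) := by
    intro T hT _
    rw [hC T hT]
    exact (Theorems.DrudeDissolution.LineSketch.regular_of_zeroWavenumberData _
      (Classical.choose_spec (hZ T hT)).1 (Classical.choose_spec (hZ T hT)).2.2.2).2.2.1
  have hbd : ∀ T : ℝ, 0 < T → T < T₁ → ∀ t : ℝ, 0 ≤ t → |C T t| ≤ B * T ^ 2 := by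
    intro T hT hTlt t ht
    rw [hC T hT]
    exact hSCB T _ D hT hTlt (hgoodT T hT) t ht
  have hwin' : ∀ δ M e : ℝ, 0 < δ → δ ≤ M → 0 < e → ∃ T₀ : ℝ, 0 < T₀ ∧ ∀ T : ℝ, 0 < T → T < T₀ →
      |(∫ t in (δ / T ^ 2)..(M / T ^ 2), C T t) - ∫ τ in δ..M, K τ| ≤ e := by
    intro δ M e hδ hδM he
    obtain ⟨T₀, hT₀, hw⟩ := hwin δ M e hδ hδM he
    refine ⟨T₀, hT₀, fun T hT hTlt => ?_⟩
    obtain ⟨μ₂, D₂, hG₂, hsh₂, hD₂, hP₂, hw₂⟩ := hw T hT hTlt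
    have hC₂ : ∀ t, D₂.currentCorrelation μ₂ t = D.currentCorrelation (Classical.choose (hZ T hT)).μ t :=
      (Theorems.DrudeDissolution.LineSketch.stub_bmRigidity ω₂ lam β γ hω hl hβ hγ T μ₂ _ D₂ D hT hG₂
        (hgoodT T hT).1 hsh₂ (hgoodT T hT).2.2.2.2.1 hD₂ hD hP₂).2.2
    rw [hC T hT]
    simp only [hC₂] at hw₂
    exact hw₂
  obtain ⟨a₀, ν₀, ha₀, hν₀, hfloor⟩ := hB C K B T₁ hT₁ hKint hKpos hcont hbd hwin'
  refine ⟨a₀, ν₀, ha₀, hν₀, fun ν hν hνle => ?_⟩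
  obtain ⟨T₀, hT₀, hfl⟩ := hfloor ν hν hνle
  refine ⟨T₀, hT₀, fun T hT hTlt => ?_⟩
  refine ⟨(Classical.choose (hZ T hT)).μ, D, (hgoodT T hT).1, (hgoodT T hT).2.2.2.2.1, hD, (hgoodT T hT).2.1, ?_⟩
  rw [← hC T hT]
  exact hfl T hT hTlt

/-- **KineticCorner's `KineticLimit` (stmt-3431) ⇒ T** (PROVED implication), through the landed
`LineSketch.bmKineticLimit_of_kineticLimit` (p127311), the rigidity plumbing `kineticAbelFloor_of_bmKineticLimit` and the
landed Abel summation B (`stub_abelFloor_of_windowLimits`, p132245): landing stmt-3431 closes the time side T; with F, `spectralWitnesses_of_sandwich` then closes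
the crux. CONDITIONAL only on its hypothesis (stmt-3431 open). [folklore] -/
theorem kineticAbelFloor_of_kineticLimit
    (hKL : Theses.KineticCorner.KineticLimit) :
    ∀ ω₂ lam β γ : ℝ, 0 < ω₂ → 0 < lam → 0 < β → 0 < γ →
      ∃ a₀ ν₀ : ℝ, 0 < a₀ ∧ 0 < ν₀ ∧ ∀ ν : ℝ, 0 < ν → ν ≤ ν₀ →
        ∃ T₀ : ℝ, 0 < T₀ ∧ ∀ T : ℝ, 0 < T → T < T₀ →
          ∃ (μ : Measure ChainConfig) (D : InfiniteChainDynamics (pinnedChain ω₂ lam β γ)),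
            (pinnedChain ω₂ lam β γ).IsChainGibbsMeasure T μ ∧
            MeasurePreserving (fun σ : ChainConfig => fun i : ℤ => σ (i + 1)) μ μ ∧
            D.carrier = (pinnedChain ω₂ lam β γ).bmGood ∧
            D.PreservesMeasure μ ∧
            a₀ ≤ ∫ t in Ioi (0 : ℝ), Real.exp (-(ν * T ^ 2 * t)) * D.currentCorrelation μ t :=
  kineticAbelFloor_of_bmKineticLimit stub_abelFloor_of_windowLimits
    (Theorems.DrudeDissolution.LineSketch.bmKineticLimit_of_kineticLimit hKL)

/-- **F → KineticLimit → crux.** With the frequency side F, route KineticCorner's `KineticLimit`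
(stmt-AtomisticToContinuum-3431) closes the crux `EmbeddedDrudeMourre.DrudeDissolution` (the time side T is supplied by
`kineticAbelFloor_of_kineticLimit`). CONDITIONAL only on its two hypotheses (F research-open, stmt-3431 open). [folklore] -/
theorem drudeDissolution_of_windowModulus_of_kineticLimit :
    (∀ ω₂ lam β γ : ℝ, 0 < ω₂ → 0 < lam → 0 < β → 0 < γ → ∃ (c₀ K T₀ : ℝ) (m : ℝ → ℝ), 0 < c₀ ∧ 0 < K ∧ 0 < T₀ ∧
      Filter.Tendsto m (nhdsWithin 0 (Set.Ioi 0)) (nhds 0) ∧ ∀ T : ℝ, 0 < T → T < T₀ → ∃ (μ : MeasureTheory.Measure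
      Literature.MathematicalPhysics.KineticTheory.HeatConduction.ChainConfig) (D :
      Literature.MathematicalPhysics.KineticTheory.HeatConduction.InfiniteChainDynamics
      (Literature.MathematicalPhysics.KineticTheory.HeatConduction.pinnedChain ω₂ lam β γ)),
      (Literature.MathematicalPhysics.KineticTheory.HeatConduction.pinnedChain ω₂ lam β γ).IsChainGibbsMeasure T μ ∧
      MeasureTheory.MeasurePreserving (fun σ :
      Literature.MathematicalPhysics.KineticTheory.HeatConduction.ChainConfig => fun i : ℤ => σ (i + 1)) μ μ ∧
      D.carrier = (Literature.MathematicalPhysics.KineticTheory.HeatConduction.pinnedChain ω₂ lam β γ).bmGood ∧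
      D.PreservesMeasure μ ∧ ∃ σ : MeasureTheory.Measure ℝ, MeasureTheory.IsFiniteMeasure σ ∧ (∀ t : ℝ,
      D.currentCorrelation μ t = ∫ ω, Real.cos (ω * t) ∂σ) ∧ ∃ g : ℝ → ℝ, ContinuousOn g (Set.Ioo (-(c₀ * T ^ 2))
      (c₀ * T ^ 2)) ∧ (∀ ω ∈ Set.Ioo (-(c₀ * T ^ 2)) (c₀ * T ^ 2), 0 ≤ g ω) ∧ (∀ ω ∈ Set.Ioo (-(c₀ * T ^ 2)) (c₀ * T
      ^ 2), g ω ≤ K) ∧ (∀ c : ℝ, 0 < c → c ≤ c₀ → ∀ ω ∈ Set.Ioo (-(c * T ^ 2)) (c * T ^ 2), |g ω - g 0| ≤ m c) ∧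
      σ.restrict (Set.Ioo (-(c₀ * T ^ 2)) (c₀ * T ^ 2)) = (MeasureTheory.volume.restrict (Set.Ioo (-(c₀ * T ^ 2))
      (c₀ * T ^ 2))).withDensity fun ω => ENNReal.ofReal (g ω)) →
    Summit.AtomisticToContinuum.FouriersLaw.Theses.KineticCorner.KineticLimit →
    Summit.AtomisticToContinuum.FouriersLaw.Theses.EmbeddedDrudeMourre.DrudeDissolution :=
  fun hF hKL => drudeDissolution_of_windowModulus_of_kineticAbelFloor hF (kineticAbelFloor_of_kineticLimit hKL)

end Summit.AtomisticToContinuum.FouriersLaw.Theorems.DrudeDissolution.NaturalScalePoissonSandwich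

end
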